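import Literature.Probability.LatticeModels.KCModifiedHMDecay
import HarnessLib

/-!
# Power decay near the boundary for subsolutions of the boundary-modified Laplacian

Topic `Literature/Probability/LatticeModels`. A variant of `KCModifiedHMDecay.end_decay_of_cuts`
(Chelkak–Smirnov 2012, proof of Thm. 6.1, eq. (6.10), multi-scale form of the weak Beurling estimate
for the walk on plaquettes killed at the frozen sides), with the hypotheses "`V = 0` off `D`, `V`
harmonic at the all-touch plaquettes of `D`" replaced by "`V ≤ 1` everywhere, `D` closed under
touching neighbours inside the box, `V` SUBharmonic at the all-touch plaquettes of `D`". This is the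
form consumed by the Dirichlet boundary condition of the Kadanoff–Ceva primitive
(Chelkak–Hongler–Izyurov 2015, §3.4, eq. (3.20): `H•(z) ≥ -C(ε)(1 - hm(z))` via the modified
Laplacian of Prop. 3.6): the function `V = (Hb - c)/K` is subharmonic at the all-touch plaquettes
(`latticeLaplacian_black_nonneg`), satisfies the contraction at the touching plaquettes with a frozen
side (`kcModLaplacian_nonneg` with dead cemetery `Hw - c = 0`), and is NOT supported in a prescribed
set. The proof is that of `end_decay_of_cuts` verbatim, the two uses of `V = 0` off `D` being replaced
by the closure of `D` (a touching neighbour of a plaquette of `D` inside the box is in `D`).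

* `decaySub_step`, **`decaySub_of_cuts`**.

Everything is proved; no named fact.

## References

* D. Chelkak, S. Smirnov, Invent. Math. 189 (2012) = arXiv:0910.2045: proof of Thm. 6.1, eq. (6.10)
  [ChelkakSmirnov2012Ising].
* D. Chelkak, C. Hongler, K. Izyurov, Ann. of Math. 181 (2015), Prop. 3.6 and §3.4 eq. (3.20)
  [ChelkakHonglerIzyurovAnnals2015].
* S. Smirnov, Ann. of Math. 172 (2010), App. B, Lemma B.2 [Smirnov2010].
-/

noncomputable section

open Finset Set SimpleGraph

namespace Literature.Probability.LatticeModels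

open WeakBeurling

/-- **The inductive step at an all-touch plaquette** (Case B), for a SUBharmonic `V` bounded by
`1`, on a set `D` closed under touching neighbours inside the box: if `V ≤ A φ r'` holds on
`D ∩ sqBox c₀ r'` for all `2r+1 ≤ r' ≤ R₀`, then it holds at every all-touch plaquette
`w ∈ D ∩ sqBox c₀ r` (`2r + 2 ≤ R₀`), by the layer cake and the weak Beurling estimate along cuts
from `c₀` avoiding the all-touch plaquettes of `D`. [cite: ChelkakSmirnov2012Ising, proof of Thm. 6.1, eq. (6.10); Smirnov2010, Lemma B.2] -/
theorem decaySub_step (Λ : Finset (Site 2)) {D : Finset (Site 2)} {V : Site 2 → ℝ}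
    (hV1 : ∀ x, V x ≤ 1) {c₀ : Site 2} {R₀ : ℕ}
    (hDcl : ∀ f ∈ D, ∀ j : Fin 4, SideTouch Λ f j → sideNbr f j ∈ sqBox c₀ R₀ → sideNbr f j ∈ D)
    (hsub : ∀ f ∈ D, (∀ j : Fin 4, SideTouch Λ f j) → 0 ≤ latticeLaplacian V f)
    (hcontr : ∀ g ∈ D, g ∈ sqBox c₀ R₀ → (∃ j : Fin 4, ¬ SideTouch Λ g j) → ∀ m : ℝ, 0 ≤ m →
      (∀ j : Fin 4, SideTouch Λ g j → V (sideNbr g j) ≤ m) → V g ≤ endTheta * m)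
    (hcut : ∀ R : ℕ, R < R₀ → ∃ (d : Site 2) (q : (zdGraph 2).Walk c₀ d), d ∉ sqBox c₀ R ∧
      ∀ z ∈ q.support, ¬ (z ∈ D ∧ ∀ j : Fin 4, SideTouch Λ z j))
    {r : ℕ} (hr : 2 * r + 2 ≤ R₀)
    (SUP : ∀ r' : ℕ, 2 * r + 1 ≤ r' → r' ≤ R₀ → ∀ x ∈ D, x ∈ sqBox c₀ (r' : ℤ) → V x ≤ endDecayConst * endProfile R₀ r')
    {w : Site 2} (hwD : w ∈ D) (hwT : ∀ j : Fin 4, SideTouch Λ w j) (hwr : w ∈ sqBox c₀ r) :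
    V w ≤ endDecayConst * endProfile R₀ r := by
  classical
  set γ := endDecayExp with hγ
  set A := endDecayConst with hA
  set C := beurlingConst with hC
  set β := beurlingExp with hβ
  set θ := endTheta with hθ
  set φ : ℕ → ℝ := endProfile R₀ with hφ
  have hγ0 : 0 < γ := endDecayExp_pos
  have hA0 : 0 < A := endDecayConst_pos
  have hC1 : 1 ≤ C := one_le_beurlingConst
  have hβ0 : 0 < β := beurlingExp_pos
  have hθ0 : 0 < θ := endTheta_pos
  have hR : (0 : ℝ) < (R₀ : ℝ) + 1 := by positivity
  have hφpos : ∀ n, 0 < φ n := endProfile_pos R₀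
  -- the set of all-touch plaquettes of `D`
  set T : Set (Site 2) := {f | f ∈ D ∧ ∀ j : Fin 4, SideTouch Λ f j} with hTdef
  have hTfin : T.Finite := (D.finite_toSet).subset fun f hf => hf.1
  have hVT : IsLatticeSubharmonicOn V T := fun f hf => hsub f hf.1 hf.2
  have hwT' : w ∈ T := ⟨hwD, hwT⟩
  -- the largest `K'` with `2^{K'+1}(r+1) ≤ R₀`
  set P : ℕ → Prop := fun K' => 2 ^ (K' + 1) * (r + 1) ≤ R₀ with hPdef
  have hP0 : P 0 := by simp only [hPdef]; omega
  have hbdd : ∀ K' : ℕ, P K' → K' ≤ R₀ := by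
    intro K' hK'
    have h1 : K' + 1 ≤ 2 ^ (K' + 1) := (Nat.lt_two_pow_self).le
    have h2 : 2 ^ (K' + 1) ≤ 2 ^ (K' + 1) * (r + 1) := Nat.le_mul_of_pos_right _ (by omega)
    simp only [hPdef] at hK'
    omega
  set K' := Nat.findGreatest P R₀ with hK'def
  have hK' : P K' := Nat.findGreatest_spec (Nat.zero_le R₀) hP0
  have hK'max : ∀ K'', P K'' → K'' ≤ K' := fun K'' h => Nat.le_findGreatest (hbdd K'' h) h
  -- scales and levels
  set s : ℕ → ℕ := fun j => 2 ^ (j + 1) * (r + 1) - 1 with hsdef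
  have hs_add : ∀ j, s j + 1 = 2 ^ (j + 1) * (r + 1) := fun j => (scale_facts r j).1
  have hs_ge : ∀ j, 2 * r + 1 ≤ s j := fun j => (scale_facts r j).2
  have hsmono : Monotone s := by
    intro i j hij
    simp only [hsdef]
    have : 2 ^ (i + 1) * (r + 1) ≤ 2 ^ (j + 1) * (r + 1) :=
      Nat.mul_le_mul_right _ (Nat.pow_le_pow_right (by norm_num) (by omega))
    omega
  have hsR : ∀ j ≤ K', s j ≤ R₀ - 1 := by
    intro j hj
    have h1 := hsmono hj
    have h2 : s K' + 1 ≤ R₀ := by rw [hs_add]; exact hK'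
    omega
  set Bf : ℕ → ℝ := fun j => θ * (A * φ (2 ^ (j + 1) * (r + 1))) with hBf
  have hBfmono : Monotone Bf := by
    intro i j hij
    simp only [hBf]
    have : φ (2 ^ (i + 1) * (r + 1)) ≤ φ (2 ^ (j + 1) * (r + 1)) :=
      endProfile_mono R₀ (Nat.mul_le_mul_right _ (Nat.pow_le_pow_right (by norm_num) (by omega)))
    exact mul_le_mul_of_nonneg_left (mul_le_mul_of_nonneg_left this hA0.le) hθ0.le
  have hBfnn : ∀ j, 0 ≤ Bf j := fun j => by simp only [hBf]; exact mul_nonneg hθ0.le (mul_nonneg hA0.le (hφpos _).le)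
  set B : ℕ → ℝ := fun j => if j ≤ K' then Bf j else max 1 (Bf K') with hBdef
  have hBmono : Monotone B := by
    intro i j hij
    simp only [hBdef]
    by_cases hi : i ≤ K' <;> by_cases hj : j ≤ K'
    · rw [if_pos hi, if_pos hj]; exact hBfmono hij
    · rw [if_pos hi, if_neg hj]; exact (hBfmono hi).trans (le_max_right _ _)
    · omega
    · rw [if_neg hi, if_neg hj]
  -- boundary bounds on `∂T`
  have hbdK : ∀ g ∈ latticeOuterBoundary T, V g ≤ B (K' + 1) := by
    intro g _
    simp only [hBdef, if_neg (Nat.not_succ_le_self K')]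
    exact (hV1 g).trans (le_max_left _ _)
  have hbd : ∀ g ∈ latticeOuterBoundary T, ∀ j ≤ K' + 1, g ∈ sqBox c₀ (s j) → V g ≤ B j := by
    intro g hg j hj hgj
    rcases Nat.lt_or_ge j (K' + 1) with hjK | hjK
    · have hjK' : j ≤ K' := Nat.lt_succ_iff.1 hjK
      simp only [hBdef, if_pos hjK']
      by_cases hgD : g ∈ D
      · have hgT : ∃ i : Fin 4, ¬ SideTouch Λ g i := by
          by_contra hall; push Not at hall; exact hg.1 ⟨hgD, hall⟩
        have hsj1 : s j + 1 ≤ R₀ := by have := hsR j hjK'; omega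
        have hm : ∀ i : Fin 4, SideTouch Λ g i → V (sideNbr g i) ≤ A * φ (s j + 1) := by
          intro i hi
          have h1 : sideNbr g i ∈ sqBox c₀ ((s j : ℤ) + 1) :=
            mem_sqBox_succ_of_adj hgj (by rw [sideNbr]; exact zdGraph_adj_add_cornerUnit g (i + 3))
          have h1' : sideNbr g i ∈ sqBox c₀ ((s j + 1 : ℕ) : ℤ) := by exact_mod_cast h1
          have h2 : sideNbr g i ∈ sqBox c₀ R₀ := sqBox_mono c₀ (by exact_mod_cast hsj1) h1'
          exact SUP (s j + 1) (by have := hs_ge j; omega) hsj1 _ (hDcl g hgD i hi h2) h1'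
        have hc := hcontr g hgD (sqBox_mono c₀ (by have := hsR j hjK'; omega) hgj) hgT (A * φ (s j + 1))
          (mul_nonneg hA0.le (hφpos _).le) hm
        simp only [hBf]
        rw [hs_add j] at hc
        exact hc
      · -- a neighbour of an all-touch plaquette of `D` inside the box lies in `D`
        exfalso
        obtain ⟨-, v, hv, k, rfl⟩ := hg
        have hsn : sideNbr v (k + 1) = v + cornerUnit k := by
          rw [sideNbr]; congr 1; fin_cases k <;> rfl
        have hbox : sideNbr v (k + 1) ∈ sqBox c₀ R₀ := by
          rw [hsn]; exact sqBox_mono c₀ (by have := hsR j hjK'; omega) hgj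
        exact hgD (hsn ▸ hDcl v hv.1 (k + 1) (hv.2 (k + 1)) hbox)
    · have : j = K' + 1 := le_antisymm hj hjK
      subst this
      exact hbdK g hg
  -- the layer cake
  have hLC := le_layerCake hTfin hVT c₀ hsmono hBmono (K' + 1) hbdK hbd w hwT'
  -- weak Beurling along the cut
  have hWB : ∀ j ≤ K', latticeHM T (sqBox c₀ (s j))ᶜ w ≤ C * (((r : ℝ) + 1) / ((s j : ℝ) + 1)) ^ β := by
    intro j hj
    have hlt : s j < R₀ := by have := hsR j hj; omega
    obtain ⟨d, q, hd, hq⟩ := hcut (s j) hlt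
    exact latticeHM_compl_sqBox_le_of_cutPath hTfin q hd (fun z hz hzT => hq z hz hzT) hwT' hwr
  have hωle : ∀ j ≤ K', latticeHM T (sqBox c₀ (s j))ᶜ w ≤ C * (2 : ℝ) ^ (-(((j : ℝ) + 1) * β)) := by
    intro j hj
    refine (hWB j hj).trans (le_of_eq ?_)
    congr 1
    have e1 : ((s j : ℝ) + 1) = (2 : ℝ) ^ ((j : ℝ) + 1) * ((r : ℝ) + 1) := by
      have h' : ((s j : ℕ) : ℝ) + 1 = ((2 ^ (j + 1) * (r + 1) : ℕ) : ℝ) := by exact_mod_cast hs_add j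
      rw [h']; push_cast; rw [← Real.rpow_natCast]; push_cast; ring
    have e2 : ((r : ℝ) + 1) / ((2 : ℝ) ^ ((j : ℝ) + 1) * ((r : ℝ) + 1)) = (2 : ℝ) ^ (-((j : ℝ) + 1)) := by
      rw [Real.rpow_neg (by norm_num)]
      field_simp
    rw [e1, e2, ← Real.rpow_mul (by norm_num)]
    ring_nf
  have hω0 : ∀ j, 0 ≤ latticeHM T (sqBox c₀ (s j))ᶜ w := fun j => (latticeHM_mem_Icc hTfin _ w).1
  have hω1 : ∀ j, latticeHM T (sqBox c₀ (s j))ᶜ w ≤ 1 := fun j => (latticeHM_mem_Icc hTfin _ w).2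
  -- split the layer-cake sum at `K'`
  rw [Finset.sum_range_succ] at hLC
  have hBj : ∀ j < K', B (j + 1) - B j = Bf (j + 1) - Bf j := by
    intro j hj; simp only [hBdef, if_pos (Nat.succ_le_of_lt hj), if_pos hj.le]
  have hB0 : B 0 = Bf 0 := by simp only [hBdef, if_pos (Nat.zero_le K')]
  -- increments
  have hpos1 : 0 ≤ (2 : ℝ) ^ γ - 1 := by
    have : (1 : ℝ) ≤ (2 : ℝ) ^ γ := Real.one_le_rpow (by norm_num) hγ0.le
    linarith
  have hθA : 0 ≤ θ * A := mul_nonneg hθ0.le hA0.le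
  have hincr : ∀ j : ℕ, Bf (j + 1) - Bf j ≤ θ * A * φ r * ((2 : ℝ) ^ (((j : ℝ) + 2) * γ) * ((2 : ℝ) ^ γ - 1)) := by
    intro j
    have h1 : φ (2 ^ (j + 2) * (r + 1)) ≤ (2 : ℝ) ^ γ * φ (2 ^ (j + 1) * (r + 1)) := endProfile_double R₀ r j
    have h2 : φ (2 ^ (j + 1) * (r + 1)) ≤ (2 : ℝ) ^ (((j : ℝ) + 2) * γ) * φ r := endProfile_le_scale R₀ r j
    simp only [hBf]
    rw [show j + 1 + 1 = j + 2 by ring]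
    calc θ * (A * φ (2 ^ (j + 2) * (r + 1))) - θ * (A * φ (2 ^ (j + 1) * (r + 1)))
        = θ * A * (φ (2 ^ (j + 2) * (r + 1)) - φ (2 ^ (j + 1) * (r + 1))) := by ring
      _ ≤ θ * A * (((2 : ℝ) ^ γ - 1) * φ (2 ^ (j + 1) * (r + 1))) := by
          apply mul_le_mul_of_nonneg_left _ hθA; linarith
      _ ≤ θ * A * (((2 : ℝ) ^ γ - 1) * ((2 : ℝ) ^ (((j : ℝ) + 2) * γ) * φ r)) := by
          apply mul_le_mul_of_nonneg_left _ hθA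
          exact mul_le_mul_of_nonneg_left h2 hpos1
      _ = θ * A * φ r * ((2 : ℝ) ^ (((j : ℝ) + 2) * γ) * ((2 : ℝ) ^ γ - 1)) := by ring
  have hincr0 : ∀ j : ℕ, 0 ≤ θ * A * φ r * ((2 : ℝ) ^ (((j : ℝ) + 2) * γ) * ((2 : ℝ) ^ γ - 1)) := fun j =>
    mul_nonneg (mul_nonneg hθA (hφpos r).le) (mul_nonneg (Real.rpow_nonneg (by norm_num) _) hpos1)
  -- the sum over `j < K'`
  have hsumK : ∑ j ∈ Finset.range K', (B (j + 1) - B j) * latticeHM T (sqBox c₀ (s j))ᶜ w ≤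
      θ * A * φ r * ((2 : ℝ) ^ γ - 1) * C * ((2 : ℝ) ^ (2 * γ - β) / endGap) := by
    calc ∑ j ∈ Finset.range K', (B (j + 1) - B j) * latticeHM T (sqBox c₀ (s j))ᶜ w
        ≤ ∑ j ∈ Finset.range K', (θ * A * φ r * ((2 : ℝ) ^ (((j : ℝ) + 2) * γ) * ((2 : ℝ) ^ γ - 1))) *
            (C * (2 : ℝ) ^ (-(((j : ℝ) + 1) * β))) := by
          refine Finset.sum_le_sum fun j hj => ?_
          have hjK : j < K' := Finset.mem_range.1 hj
          rw [hBj j hjK]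
          exact mul_le_mul (hincr j) (hωle j hjK.le) (hω0 j) (hincr0 j)
      _ = θ * A * φ r * ((2 : ℝ) ^ γ - 1) * C *
            ∑ j ∈ Finset.range K', (2 : ℝ) ^ (((j : ℝ) + 2) * γ) * (2 : ℝ) ^ (-(((j : ℝ) + 1) * β)) := by
          rw [Finset.mul_sum]; refine Finset.sum_congr rfl fun j _ => ?_; ring
      _ ≤ θ * A * φ r * ((2 : ℝ) ^ γ - 1) * C * ((2 : ℝ) ^ (2 * γ - β) / endGap) := by
          apply mul_le_mul_of_nonneg_left (end_geom_bound K')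
          have := hφpos r
          exact mul_nonneg (mul_nonneg (mul_nonneg hθA this.le) hpos1) (by linarith)
  -- the last term
  have hlast : (B (K' + 1) - B K') * latticeHM T (sqBox c₀ (s K'))ᶜ w ≤ C * (4 : ℝ) ^ β * φ r := by
    have hBK1 : B (K' + 1) - B K' ≤ 1 := by
      simp only [hBdef, if_neg (Nat.not_succ_le_self K'), if_pos le_rfl]
      have := hBfnn K'
      rcases le_total 1 (Bf K') with h | h
      · rw [max_eq_right h]; linarith
      · rw [max_eq_left h]; linarith
    have hBd : 0 ≤ B (K' + 1) - B K' := sub_nonneg.2 (hBmono (Nat.le_succ K'))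
    have h1 : (B (K' + 1) - B K') * latticeHM T (sqBox c₀ (s K'))ᶜ w ≤ latticeHM T (sqBox c₀ (s K'))ᶜ w := by
      have := hω0 K'
      calc (B (K' + 1) - B K') * latticeHM T (sqBox c₀ (s K'))ᶜ w ≤ 1 * latticeHM T (sqBox c₀ (s K'))ᶜ w :=
            mul_le_mul_of_nonneg_right hBK1 this
        _ = _ := one_mul _
    refine h1.trans ((hWB K' le_rfl).trans ?_)
    have hmax : R₀ < 2 ^ (K' + 2) * (r + 1) := by
      by_contra hle
      push Not at hle
      have := hK'max (K' + 1) (by simp only [hPdef]; exact hle)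
      omega
    have hNpos : (0 : ℝ) < ((2 ^ (K' + 1) * (r + 1) : ℕ) : ℝ) := by positivity
    have e1 : ((s K' : ℝ) + 1) = ((2 ^ (K' + 1) * (r + 1) : ℕ) : ℝ) := by exact_mod_cast hs_add K'
    have hRN : (R₀ : ℝ) + 1 ≤ 2 * ((2 ^ (K' + 1) * (r + 1) : ℕ) : ℝ) := by
      have h' : R₀ + 1 ≤ 2 * (2 ^ (K' + 1) * (r + 1)) := by
        rw [show 2 * (2 ^ (K' + 1) * (r + 1)) = 2 ^ (K' + 2) * (r + 1) by ring]; exact hmax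
      exact_mod_cast h'
    have hq : ((r : ℝ) + 1) / ((s K' : ℝ) + 1) ≤ 4 * (((r : ℝ) + 1) / ((R₀ : ℝ) + 1)) := by
      rw [e1, mul_div_assoc', div_le_div_iff₀ hNpos hR]
      have hr0 : (0 : ℝ) ≤ (r : ℝ) + 1 := by positivity
      nlinarith
    have hq0 : 0 ≤ ((r : ℝ) + 1) / ((s K' : ℝ) + 1) := by positivity
    have hrR : ((r : ℝ) + 1) / ((R₀ : ℝ) + 1) ≤ 1 := (div_le_one hR).2 (by
      have : ((2 * r + 2 : ℕ) : ℝ) ≤ (R₀ : ℝ) := by exact_mod_cast hr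
      push_cast at this; linarith)
    calc C * (((r : ℝ) + 1) / ((s K' : ℝ) + 1)) ^ β ≤ C * (4 * (((r : ℝ) + 1) / ((R₀ : ℝ) + 1))) ^ β := by
          apply mul_le_mul_of_nonneg_left _ (by linarith)
          exact Real.rpow_le_rpow hq0 hq hβ0.le
      _ = C * (4 : ℝ) ^ β * (((r : ℝ) + 1) / ((R₀ : ℝ) + 1)) ^ β := by
          rw [Real.mul_rpow (by norm_num) (by positivity)]; ring
      _ ≤ C * (4 : ℝ) ^ β * φ r := by
          apply mul_le_mul_of_nonneg_left _ (by positivity)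
          exact Real.rpow_le_rpow_of_exponent_ge (by positivity) hrR endDecayExp_le_beurlingExp
  -- `B 0 ≤ θ A φ r 2^{2γ}`
  have hB0le : B 0 ≤ θ * A * φ r * (2 : ℝ) ^ (2 * γ) := by
    rw [hB0]
    simp only [hBf]
    have h : φ (2 ^ (0 + 1) * (r + 1)) ≤ (2 : ℝ) ^ ((((0 : ℕ) : ℝ) + 2) * γ) * φ r := endProfile_le_scale R₀ r 0
    have e0 : (((0 : ℕ) : ℝ) + 2) * γ = 2 * γ := by push_cast; ring
    rw [e0] at h
    calc θ * (A * φ (2 ^ (0 + 1) * (r + 1))) = θ * A * φ (2 ^ (0 + 1) * (r + 1)) := by ring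
      _ ≤ θ * A * ((2 : ℝ) ^ (2 * γ) * φ r) := mul_le_mul_of_nonneg_left h hθA
      _ = θ * A * φ r * (2 : ℝ) ^ (2 * γ) := by ring
  -- total
  have htotal : V w ≤ φ r * (θ * A * ((2 : ℝ) ^ (2 * γ) + ((2 : ℝ) ^ γ - 1) * C * ((2 : ℝ) ^ (2 * γ - β) / endGap)) +
      C * (4 : ℝ) ^ β) := by
    have e : φ r * (θ * A * ((2 : ℝ) ^ (2 * γ) + ((2 : ℝ) ^ γ - 1) * C * ((2 : ℝ) ^ (2 * γ - β) / endGap)) +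
        C * (4 : ℝ) ^ β) = θ * A * φ r * (2 : ℝ) ^ (2 * γ) +
        θ * A * φ r * ((2 : ℝ) ^ γ - 1) * C * ((2 : ℝ) ^ (2 * γ - β) / endGap) + C * (4 : ℝ) ^ β * φ r := by ring
    rw [e]
    linarith [hLC, hsumK, hlast, hB0le]
  have hnum := end_decay_numeric
  calc V w ≤ φ r * (θ * A * ((2 : ℝ) ^ (2 * γ) + ((2 : ℝ) ^ γ - 1) * C * ((2 : ℝ) ^ (2 * γ - β) / endGap)) +
      C * (4 : ℝ) ^ β) := htotal
    _ ≤ φ r * A := mul_le_mul_of_nonneg_left hnum (hφpos r).le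
    _ = A * φ r := by ring

/-- **Power decay near a boundary point for subharmonic functions with the boundary contraction**
(the estimate `V^δ = O(μ^β)` of Chelkak–Smirnov 2012, proof of Thm. 6.1, in the boundary-modification
rendering, for a general subsolution). Let `D` be a finite set of plaquettes closed under touching
neighbours inside `sqBox c₀ R₀`, `V : Site 2 → ℝ` with `V ≤ 1` everywhere, `V` plain-SUBharmonic at
the plaquettes of `D` whose four sides touch `Λ`, and satisfying the contraction `V g ≤ θ₀ · m`
whenever `g ∈ D ∩ sqBox c₀ R₀` has a non-touching side and `V ≤ m` (`m ≥ 0`) at its touching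
neighbours. Suppose that for every `R < R₀` some lattice walk from `c₀` leaves `sqBox c₀ R` avoiding
the all-touch plaquettes of `D`. Then for `r ≤ R₀` and `w ∈ D ∩ sqBox c₀ r`,
`V w ≤ A ((r+1)/(R₀+1))^γ` (same universal `A`, `γ` as `end_decay_of_cuts`). [cite: ChelkakSmirnov2012Ising, proof of Thm. 6.1, eq. (6.10); Smirnov2010, Lemma B.2] -/
theorem decaySub_of_cuts (Λ : Finset (Site 2)) {D : Finset (Site 2)} {V : Site 2 → ℝ}
    (hV1 : ∀ x, V x ≤ 1) {c₀ : Site 2} {R₀ : ℕ}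
    (hDcl : ∀ f ∈ D, ∀ j : Fin 4, SideTouch Λ f j → sideNbr f j ∈ sqBox c₀ R₀ → sideNbr f j ∈ D)
    (hsub : ∀ f ∈ D, (∀ j : Fin 4, SideTouch Λ f j) → 0 ≤ latticeLaplacian V f)
    (hcontr : ∀ g ∈ D, g ∈ sqBox c₀ R₀ → (∃ j : Fin 4, ¬ SideTouch Λ g j) → ∀ m : ℝ, 0 ≤ m →
      (∀ j : Fin 4, SideTouch Λ g j → V (sideNbr g j) ≤ m) → V g ≤ endTheta * m)
    (hcut : ∀ R : ℕ, R < R₀ → ∃ (d : Site 2) (q : (zdGraph 2).Walk c₀ d), d ∉ sqBox c₀ R ∧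
      ∀ z ∈ q.support, ¬ (z ∈ D ∧ ∀ j : Fin 4, SideTouch Λ z j)) :
    ∀ r : ℕ, r ≤ R₀ → ∀ w ∈ D, w ∈ sqBox c₀ r → V w ≤ endDecayConst * endProfile R₀ r := by
  classical
  set A := endDecayConst with hA
  set θ := endTheta with hθ
  set φ : ℕ → ℝ := endProfile R₀ with hφ
  have hγ0 : 0 < endDecayExp := endDecayExp_pos
  have hA0 : 0 < A := endDecayConst_pos
  have hθ0 : 0 < θ := endTheta_pos
  have hθ1 : θ ≤ 15 / 19 := endTheta_le
  have hR : (0 : ℝ) < (R₀ : ℝ) + 1 := by positivity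
  have hφpos : ∀ n, 0 < φ n := endProfile_pos R₀
  -- strong downward induction on `r`, via `d = R₀ - r`
  suffices H : ∀ d : ℕ, ∀ r : ℕ, R₀ - r ≤ d → r ≤ R₀ → ∀ w ∈ D, w ∈ sqBox c₀ r → V w ≤ A * φ r by
    intro r hr w hw hwr; exact H (R₀ - r) r le_rfl hr w hw hwr
  intro d
  induction d using Nat.strong_induction_on with
  | _ d ih =>
  intro r hrd hrR w hwD hwr
  -- base: `2r + 2 > R₀`
  by_cases hbase : R₀ ≤ 2 * r + 1
  · have h1 : (1 : ℝ) / 2 ≤ ((r : ℝ) + 1) / ((R₀ : ℝ) + 1) := by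
      rw [div_le_div_iff₀ (by norm_num) hR]
      have : (R₀ : ℝ) ≤ 2 * r + 1 := by exact_mod_cast hbase
      linarith
    have h2 : (1 : ℝ) / 2 ≤ φ r := by
      calc (1 : ℝ) / 2 = (1 / 2) ^ (1 : ℝ) := by norm_num
        _ ≤ (1 / 2 : ℝ) ^ endDecayExp := Real.rpow_le_rpow_of_exponent_ge (by norm_num) (by norm_num) (endDecayExp_le.trans (by norm_num))
        _ ≤ φ r := Real.rpow_le_rpow (by norm_num) h1 hγ0.le
    calc V w ≤ 1 := hV1 w
      _ ≤ A * φ r := by nlinarith [endDecayConst_ge]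
  push Not at hbase
  -- the bound at all scales `r' ≥ 2r + 1`
  have SUP : ∀ r' : ℕ, 2 * r + 1 ≤ r' → r' ≤ R₀ → ∀ x ∈ D, x ∈ sqBox c₀ (r' : ℤ) → V x ≤ A * φ r' := by
    intro r' h1 h2 x hxD hx
    exact ih (R₀ - r') (by omega) r' le_rfl h2 x hxD hx
  by_cases hwT : ∀ j : Fin 4, SideTouch Λ w j
  · -- Case B
    exact decaySub_step Λ hV1 hDcl hsub hcontr hcut (by omega) SUP hwD hwT hwr
  · -- Case A: contraction
    push Not at hwT
    have hm : ∀ j : Fin 4, SideTouch Λ w j → V (sideNbr w j) ≤ A * φ (2 * r + 1) := by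
      intro j hj
      have h1 : sideNbr w j ∈ sqBox c₀ ((r : ℤ) + 1) :=
        mem_sqBox_succ_of_adj hwr (by rw [sideNbr]; exact zdGraph_adj_add_cornerUnit w (j + 3))
      have h2 : sideNbr w j ∈ sqBox c₀ ((2 * r + 1 : ℕ) : ℤ) := sqBox_mono c₀ (by push_cast; omega) h1
      have h3 : sideNbr w j ∈ sqBox c₀ R₀ := sqBox_mono c₀ (by omega) h1
      exact SUP (2 * r + 1) le_rfl (by omega) _ (hDcl w hwD j hj h3) h2
    have hc := hcontr w hwD (sqBox_mono c₀ (by exact_mod_cast hrR) hwr) hwT (A * φ (2 * r + 1))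
      (mul_nonneg hA0.le (hφpos _).le) hm
    have hφ2 : φ (2 * r + 1) = (2 : ℝ) ^ endDecayExp * φ r := by
      have h := endProfile_scale R₀ r 1
      rw [show 2 ^ 1 * (r + 1) - 1 = 2 * r + 1 by omega] at h
      simpa using h
    rw [hφ2] at hc
    have h2γ := two_rpow_endDecayExp_le
    have h2γ0 : 0 ≤ (2 : ℝ) ^ endDecayExp := Real.rpow_nonneg (by norm_num) _
    have hθ2 : θ * (2 : ℝ) ^ endDecayExp ≤ 1 := by nlinarith
    have hAφ : 0 ≤ A * φ r := mul_nonneg hA0.le (hφpos r).le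
    calc V w ≤ θ * (A * ((2 : ℝ) ^ endDecayExp * φ r)) := hc
      _ = (θ * (2 : ℝ) ^ endDecayExp) * (A * φ r) := by ring
      _ ≤ 1 * (A * φ r) := mul_le_mul_of_nonneg_right hθ2 hAφ
      _ = A * φ r := one_mul _

end Literature.Probability.LatticeModels
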